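import Literature.MathematicalPhysics.QuantumFieldTheory.ConformalBootstrap3D.PointKernelK34v2Data

/-!
# K34v2 certificate, kernel block file H1: head segments `14 ≤ i < 24` (block-checked ones)

`decide` by kernel reduction (no `native_decide`, no extra axioms) of the block checker
`PCert.hBlockOK` of `PointKernel` on the literal data of `PointKernelK34v2Data` (cells checked corner
or chord by the rule bit); soundness is `PCert.hBlockOK_sound`.  Estimated kernel time 251 s
(5 theorems).
-/

set_option maxRecDepth 100000
set_option maxHeartbeats 0

namespace Literature.MathematicalPhysics.QuantumFieldTheory.ConformalBootstrap3D.PointKernelK34v2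

open Literature.MathematicalPhysics.QuantumFieldTheory.ConformalBootstrap3D.PointKernel

/-- head segments `[14, 16)` pass the kernel evaluator (≈47 s of kernel work). [folklore] -/
theorem hBlock_14 : certK34v2.hBlockOK hsegsK34v2 14 16 JHK34v2 = true := by
  decide +kernel

/-- head segments `[16, 18)` pass the kernel evaluator (≈47 s of kernel work). [folklore] -/
theorem hBlock_16 : certK34v2.hBlockOK hsegsK34v2 16 18 JHK34v2 = true := by
  decide +kernel

/-- head segments `[18, 20)` pass the kernel evaluator (≈47 s of kernel work). [folklore] -/
theorem hBlock_18 : certK34v2.hBlockOK hsegsK34v2 18 20 JHK34v2 = true := by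
  decide +kernel

/-- head segments `[20, 22)` pass the kernel evaluator (≈47 s of kernel work). [folklore] -/
theorem hBlock_20 : certK34v2.hBlockOK hsegsK34v2 20 22 JHK34v2 = true := by
  decide +kernel

/-- head segments `[22, 24)` pass the kernel evaluator (≈47 s of kernel work). [folklore] -/
theorem hBlock_22 : certK34v2.hBlockOK hsegsK34v2 22 24 JHK34v2 = true := by
  decide +kernel

end Literature.MathematicalPhysics.QuantumFieldTheory.ConformalBootstrap3D.PointKernelK34v2
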